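import Mathlib
import HarnessLib
import Summits.Ventures.LatticeQCDFlow.Exactness.KickedProductTwoPoint
import Summits.Ventures.LatticeQCDFlow.Exactness.KickedProductSequence

/-!
# Kicked products with step-indexed kicks: the two-trajectory (discrete Grönwall) estimate — step 2 of the OMF ergodicity roadmap (R1)

HONEST FRAMING: exact (Metropolis-corrected) sampling algorithms for lattice gauge theory;
figures of merit are autocorrelation/cost numbers at stated couplings and volumes; no
continuum-physics claim.

Venture `LatticeQCDFlow` (cell pub-lqcd), topic `Exactness`, FANOUT row 9 (eng-latcore, GEN-25; the engine's
`hmc.HMC(f, β, 'omf2').trajectory(τ, nstep, tau_jitter)` on 4D `SU(N)`: every drift of the OMF2 word has the SAME length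
`ε/2`, the merged kicks alternate — exactly the setting below).  NEW WORK of the cell: gen-18's `plfTraj_two_point` /
`plfTraj_fst_approx` / `plfTraj_fst_lipschitz` (`KickedProductTwoPoint.lean`) re-run VERBATIM for the step-indexed kicked
product `plfSeqTraj ex J Gs (fun _ => δ)` of GEN-25's `KickedProductSequence.lean` (constant drift length `δ`, merged kicks
`Gs k` each bounded by `b` and `K`-Lipschitz on the group — `PLFSeqBounds`).  The constants are gen-18's (`plfSmall`,
`plfRate`, `Θ = nδ‖J‖(R + (2n+1)b)`); the one-trajectory inputs of `KickedProductSequence` are weakened to gen-18's shapes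
(`norm_seqDriftArg_le_gen18`, `norm_plfSeqTraj_fst_sub_one_le_gen18`).  Mathlib only; nothing is cited as a fact; no number
is claimed.

## Content

`norm_seqDriftArg_le_gen18`, `norm_plfSeqTraj_fst_sub_one_le_gen18`; **`plfSeqTraj_two_point`** — under `PLFSeqBounds`,
`δ ≥ 0`, `‖p‖, ‖p'‖ ≤ R`, `Θ ≤ ρ`, `plfSmall ≤ 1`: for every `k ≤ n`, `‖Δm_k − Δp‖ ≤ K(δ‖J‖ + 3g)·k(k+1)·‖Δp‖` and
`‖ΔW_k − (kδ)•JΔp‖ ≤ 3g·k·‖Δp‖`; **`plfSeqTraj_fst_approx`** (`‖W_n(p) − W_n(p') − (nδ)•J(p − p')‖ ≤ plfSmall·(nδ‖J‖)·‖p − p'‖`);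
**`plfSeqTraj_fst_lipschitz`**.

NOT CLAIMED: variable drift lengths (OMF4's `ρε, θε, …` need the sum `Σ δs` in place of `kδ` — the next port); any
position law, kernel or threshold; floating point.
-/

noncomputable section

namespace Summit.Ventures.LatticeQCDFlow.Exactness

open Set NNReal

variable {𝔸 : Type*} [NormedRing 𝔸] [NormedAlgebra ℝ 𝔸]
variable {V : Type*} [NormedAddCommGroup V] [NormedSpace ℝ V]

section TwoTrajectories

/-- The drift arguments in gen-18's shape: `‖δ • J m_k‖ ≤ δ‖J‖(R + (2n+1) b)` for `k ≤ n` (`δ ≥ 0`, `‖p‖ ≤ R`). -/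
theorem norm_seqDriftArg_le_gen18 {ex : 𝔸 → 𝔸} {J : V →L[ℝ] 𝔸} {Gs : ℕ → 𝔸 → V} {T : Set 𝔸} {C b K ρ η : ℝ}
    (h : PLFSeqBounds ex J Gs T C b K ρ η) {δ : ℝ} (hδ : 0 ≤ δ) (p : V) {R : ℝ} (hp : ‖p‖ ≤ R) {n k : ℕ} (hk : k ≤ n) :
    ‖δ • J (plfSeqTraj ex J Gs (fun _ => δ) p k).2‖ ≤ δ * ‖J‖ * (R + (2 * n + 1) * b) := by
  have hb : 0 ≤ b := (norm_nonneg _).trans (h.force_le 0 1 h.one_mem)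
  refine (norm_seqDriftArg_le h (fun _ => δ) p hp (fun _ => hδ) (fun _ => le_rfl) hk).trans ?_
  have hn0 : (0 : ℝ) ≤ n := n.cast_nonneg
  have h1 : R + ((n : ℝ) + 1) * b ≤ R + (2 * n + 1) * b := by nlinarith
  exact mul_le_mul_of_nonneg_left h1 (mul_nonneg hδ (norm_nonneg _))

/-- `‖W_k − 1‖ ≤ 2kθC` in gen-18's shape (`θ = δ‖J‖(R + (2n+1)b) ≤ ρ`). -/
theorem norm_plfSeqTraj_fst_sub_one_le_gen18 {ex : 𝔸 → 𝔸} {J : V →L[ℝ] 𝔸} {Gs : ℕ → 𝔸 → V} {T : Set 𝔸}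
    {C b K ρ η : ℝ} (h : PLFSeqBounds ex J Gs T C b K ρ η) {δ : ℝ} (hδ : 0 ≤ δ) (p : V) {R : ℝ} (hp : ‖p‖ ≤ R) {n : ℕ}
    (hρ : δ * ‖J‖ * (R + (2 * n + 1) * b) ≤ ρ) :
    ∀ k ≤ n, ‖(plfSeqTraj ex J Gs (fun _ => δ) p k).1 - 1‖ ≤ k * (2 * (δ * ‖J‖ * (R + (2 * n + 1) * b)) * C) := by
  intro k hk
  have hb : 0 ≤ b := (norm_nonneg _).trans (h.force_le 0 1 h.one_mem)
  have hC : 0 ≤ C := zero_le_one.trans h.one_le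
  have hn0 : (0 : ℝ) ≤ n := n.cast_nonneg
  have h1 : R + ((n : ℝ) + 1) * b ≤ R + (2 * n + 1) * b := by nlinarith
  have hθ' : δ * ‖J‖ * (R + ((n : ℝ) + 1) * b) ≤ δ * ‖J‖ * (R + (2 * n + 1) * b) :=
    mul_le_mul_of_nonneg_left h1 (mul_nonneg hδ (norm_nonneg _))
  refine (norm_plfSeqTraj_fst_sub_one_le h (fun _ => δ) p hp (fun _ => hδ) (fun _ => le_rfl) (hθ'.trans hρ) k hk).trans ?_
  exact mul_le_mul_of_nonneg_left (mul_le_mul_of_nonneg_right (mul_le_mul_of_nonneg_left hθ' zero_le_two) hC) k.cast_nonneg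

variable {ex : 𝔸 → 𝔸} {J : V →L[ℝ] 𝔸} {Gs : ℕ → 𝔸 → V} {T : Set 𝔸} {C b K ρ η : ℝ}
  (h : PLFSeqBounds ex J Gs T C b K ρ η)
include h

/-- **THE JOINT INDUCTION (discrete Grönwall with bilinear defect).**  Under `PLFBounds`, `δ ≥ 0`,
`‖p‖, ‖p'‖ ≤ R`, `Θ = nδ‖J‖(R + (2n+1)b) ≤ ρ` and `plfSmall ≤ 1`: for every `k ≤ n`,
`‖Δm_k − Δp‖ ≤ K(δ‖J‖ + 3g)·k(k+1)·‖Δp‖` and `‖ΔW_k − (kδ)•JΔp‖ ≤ 3g·k·‖Δp‖` (`g = plfRate`). -/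
theorem plfSeqTraj_two_point {δ : ℝ} (hδ : 0 ≤ δ) {n : ℕ} {R : ℝ} {p p' : V} (hp : ‖p‖ ≤ R) (hp' : ‖p'‖ ≤ R)
    (hρ : n * (δ * ‖J‖ * (R + (2 * n + 1) * b)) ≤ ρ) (hS : plfSmall J C K η δ b R n ≤ 1) :
    ∀ k ≤ n,
      ‖(plfSeqTraj ex J Gs (fun _ => δ) p k).2 - (plfSeqTraj ex J Gs (fun _ => δ) p' k).2 - (p - p')‖ ≤
          K * (δ * ‖J‖ + 3 * plfRate J C K η δ b R n) * ((k : ℝ) * (k + 1)) * ‖p - p'‖ ∧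
      ‖(plfSeqTraj ex J Gs (fun _ => δ) p k).1 - (plfSeqTraj ex J Gs (fun _ => δ) p' k).1 - ((k : ℝ) * δ) • J (p - p')‖ ≤
          3 * plfRate J C K η δ b R n * k * ‖p - p'‖ := by
  -- constants (kept as real atoms; no abbreviation for `Θ = nθ`)
  set θ : ℝ := δ * ‖J‖ * (R + (2 * n + 1) * b) with hθdef
  set S : ℝ := plfSmall J C K η δ b R n with hSdef
  set g : ℝ := plfRate J C K η δ b R n with hgdef
  set N : ℝ := ‖p - p'‖ with hN
  have hg : g = δ * ‖J‖ * S / 3 := rfl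
  have hSexp : S = 6 * (n * θ) * (1 + 2 * C) + 6 * η * C + 12 * (K * δ * (n : ℝ) ^ 2 * ‖J‖) := rfl
  have hK0 : 0 ≤ K := h.lip_nonneg
  have hC1 : 1 ≤ C := h.one_le
  have hC0 : 0 ≤ C := (zero_le_one.trans h.one_le)
  have hη0 : 0 ≤ η := h.defect_nonneg
  have hb0 : 0 ≤ b := (norm_nonneg _).trans (h.force_le 0 1 h.one_mem)
  have hJ0 : 0 ≤ ‖J‖ := norm_nonneg _
  have hN0 : 0 ≤ N := norm_nonneg _
  have hn0 : 0 ≤ (n : ℝ) := n.cast_nonneg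
  have hR0 : 0 ≤ R := (norm_nonneg _).trans hp
  have hδJ : 0 ≤ δ * ‖J‖ := mul_nonneg hδ hJ0
  have hθ0 : 0 ≤ θ := by positivity
  have hnθ0 : 0 ≤ n * θ := mul_nonneg hn0 hθ0
  have hκ0 : 0 ≤ K * δ * (n : ℝ) ^ 2 * ‖J‖ := by positivity
  have hS0 : 0 ≤ S := by rw [hSexp]; positivity
  have hg0 : 0 ≤ g := by rw [hg]; positivity
  obtain ⟨hΘ6, hκ12⟩ := plf_arith_small hnθ0 hC1 hη0 hκ0 (hSexp ▸ hS)
  have hg3 : 3 * g ≤ δ * ‖J‖ := by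
    have h1 : δ * ‖J‖ * S ≤ δ * ‖J‖ * 1 := mul_le_mul_of_nonneg_left hS hδJ
    rw [hg]; linarith
  have hgS : 3 * g = δ * ‖J‖ * S := by rw [hg]; ring
  intro k
  induction k with
  | zero =>
    intro _
    constructor
    · have h0 : (plfSeqTraj ex J Gs (fun _ => δ) p 0).2 - (plfSeqTraj ex J Gs (fun _ => δ) p' 0).2 - (p - p') = 0 := by
        simp only [plfSeqTraj_zero]; abel
      rw [h0, norm_zero]; simp
    · simp
  | succ k ih =>
    intro hk
    have hkn : k ≤ n := Nat.le_of_succ_le hk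
    have hkn' : (k : ℝ) + 1 ≤ n := by exact_mod_cast hk
    have hknr : (k : ℝ) ≤ n := Nat.cast_le.2 hkn
    have hk0 : 0 ≤ (k : ℝ) := k.cast_nonneg
    have hn1 : (1 : ℝ) ≤ n := by linarith
    obtain ⟨iha, ihb⟩ := ih hkn
    -- abbreviations
    set W := (plfSeqTraj ex J Gs (fun _ => δ) p k).1 with hW
    set W' := (plfSeqTraj ex J Gs (fun _ => δ) p' k).1 with hW'
    set m := (plfSeqTraj ex J Gs (fun _ => δ) p k).2 with hm
    set m' := (plfSeqTraj ex J Gs (fun _ => δ) p' k).2 with hm'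
    set a := δ • J m with ha
    set a' := δ • J m' with ha'
    have hWT : W ∈ T := plfSeqTraj_fst_mem h (fun _ => δ) p k
    have hW'T : W' ∈ T := plfSeqTraj_fst_mem h (fun _ => δ) p' k
    have haθ : ‖a‖ ≤ θ := norm_seqDriftArg_le_gen18 h hδ p hp hkn
    have ha'θ : ‖a'‖ ≤ θ := norm_seqDriftArg_le_gen18 h hδ p' hp' hkn
    have hθΘ : θ ≤ n * θ := le_mul_of_one_le_left hθ0 hn1
    have hθρ : θ ≤ ρ := hθΘ.trans hρ
    have haρ : ‖a‖ ≤ ρ := haθ.trans hθρ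
    have ha'ρ : ‖a'‖ ≤ ρ := ha'θ.trans hθρ
    -- sizes along one trajectory
    have hWC : ‖W‖ ≤ C := h.norm_le W hWT
    have hW1 : ‖W - 1‖ ≤ 2 * (n * θ) * C := by
      refine (norm_plfSeqTraj_fst_sub_one_le_gen18 h hδ p hp (n := n) hθρ k hkn).trans ?_
      have h1 : (k : ℝ) * (2 * θ * C) ≤ n * (2 * θ * C) := mul_le_mul_of_nonneg_right hknr (by positivity)
      linarith
    -- differences: momenta, drift arguments, configurations
    have hea : ‖m - m' - (p - p')‖ ≤ 4 * (K * δ * (n : ℝ) ^ 2 * ‖J‖) * N := by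
      refine iha.trans ?_
      have h1 := plf_arith_trap (g := g) hK0 hδJ hk0 hkn' hg3
      have h2 : K * (δ * ‖J‖ + 3 * g) * ((k : ℝ) * (k + 1)) * N ≤ 4 * (K * (n : ℝ) ^ 2 * (δ * ‖J‖)) * N :=
        mul_le_mul_of_nonneg_right h1 hN0
      refine h2.trans (le_of_eq ?_); ring
    have hea1 : ‖m - m' - (p - p')‖ ≤ N := by
      refine hea.trans ?_
      have h1 : 4 * (K * δ * (n : ℝ) ^ 2 * ‖J‖) * N ≤ 1 * N := mul_le_mul_of_nonneg_right (by linarith) hN0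
      linarith
    have hΔm : ‖m - m'‖ ≤ 2 * N := by
      calc ‖m - m'‖ = ‖(m - m' - (p - p')) + (p - p')‖ := by rw [sub_add_cancel]
        _ ≤ ‖m - m' - (p - p')‖ + N := norm_add_le _ _
        _ ≤ 2 * N := by linarith
    have hΔa : ‖a - a'‖ ≤ δ * ‖J‖ * (2 * N) := by
      rw [ha, ha', ← smul_sub, ← map_sub, norm_smul, Real.norm_of_nonneg hδ, mul_assoc]
      exact mul_le_mul_of_nonneg_left ((J.le_opNorm _).trans (mul_le_mul_of_nonneg_left hΔm hJ0)) hδ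
    have hΔa' : ‖a - a' - δ • J (p - p')‖ ≤ δ * ‖J‖ * (4 * (K * δ * (n : ℝ) ^ 2 * ‖J‖) * N) := by
      rw [ha, ha', ← smul_sub, ← map_sub, ← smul_sub, ← map_sub, norm_smul, Real.norm_of_nonneg hδ, mul_assoc]
      exact mul_le_mul_of_nonneg_left ((J.le_opNorm _).trans (mul_le_mul_of_nonneg_left hea hJ0)) hδ
    have hΔW : ‖W - W'‖ ≤ n * (δ * ‖J‖) * N + 3 * g * k * N := by
      calc ‖W - W'‖ = ‖(W - W' - ((k : ℝ) * δ) • J (p - p')) + ((k : ℝ) * δ) • J (p - p')‖ := by rw [sub_add_cancel]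
        _ ≤ ‖W - W' - ((k : ℝ) * δ) • J (p - p')‖ + ‖((k : ℝ) * δ) • J (p - p')‖ := norm_add_le _ _
        _ ≤ 3 * g * k * N + k * (δ * (‖J‖ * N)) := by
            refine add_le_add ihb ?_
            rw [norm_smul, Real.norm_of_nonneg (mul_nonneg hk0 hδ), mul_assoc]
            exact mul_le_mul_of_nonneg_left (mul_le_mul_of_nonneg_left (J.le_opNorm _) hδ) hk0
        _ ≤ n * (δ * ‖J‖) * N + 3 * g * k * N := by
            have h1 : (k : ℝ) * (δ * (‖J‖ * N)) ≤ n * (δ * (‖J‖ * N)) :=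
              mul_le_mul_of_nonneg_right hknr (by positivity)
            linarith
    -- (b_{k+1}): the configuration estimate
    have hWs : (plfSeqTraj ex J Gs (fun _ => δ) p (k + 1)).1 = ex a * W := plfSeqTraj_succ_fst ex J Gs (fun _ => δ) p k
    have hWs' : (plfSeqTraj ex J Gs (fun _ => δ) p' (k + 1)).1 = ex a' * W' := plfSeqTraj_succ_fst ex J Gs (fun _ => δ) p' k
    have hb : ‖(plfSeqTraj ex J Gs (fun _ => δ) p (k + 1)).1 - (plfSeqTraj ex J Gs (fun _ => δ) p' (k + 1)).1 -
        (((↑(k + 1) : ℝ)) * δ) • J (p - p')‖ ≤ 3 * g * (↑(k + 1) : ℝ) * N := by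
      have hsplit : (((↑(k + 1) : ℝ)) * δ) • J (p - p') = ((k : ℝ) * δ) • J (p - p') + δ • J (p - p') := by
        push_cast; rw [add_mul, one_mul, add_smul]
      rw [hWs, hWs', hsplit, plf_step_identity W W' (ex a) (ex a') (a - a') (((k : ℝ) * δ) • J (p - p')) (δ • J (p - p'))]
      have t1 : ‖(ex a' - 1) * (W - W')‖ ≤ 2 * θ * (n * (δ * ‖J‖) * N + 3 * g * k * N) :=
        (norm_mul_le _ _).trans (mul_le_mul ((norm_ex_sub_one_le_of_defect h.ex_zero h.ex_defect h.defect_le_one h.radius_nonneg ha'ρ).trans (by linarith)) hΔW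
          (norm_nonneg _) (by positivity))
      have t2 : ‖(ex a - ex a' - (a - a')) * W‖ ≤ η * (δ * ‖J‖ * (2 * N)) * C :=
        (norm_mul_le _ _).trans (mul_le_mul ((h.ex_defect a a' haρ ha'ρ).trans
          (mul_le_mul_of_nonneg_left hΔa hη0)) hWC (norm_nonneg _) (by positivity))
      have t3 : ‖(a - a') * (W - 1)‖ ≤ δ * ‖J‖ * (2 * N) * (2 * (n * θ) * C) :=
        (norm_mul_le _ _).trans (mul_le_mul hΔa hW1 (norm_nonneg _) (by positivity))
      have harith := plf_arith_step (g := g) (κJ := K * δ * (n : ℝ) ^ 2 * ‖J‖) hθ0 hδJ hη0 hC0 hκ0 hN0 hn0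
        hknr hgS hSexp hS0 hS
      calc ‖W - W' - ((k : ℝ) * δ) • J (p - p') + (ex a' - 1) * (W - W') + (ex a - ex a' - (a - a')) * W +
            (a - a') * (W - 1) + (a - a' - δ • J (p - p'))‖
          ≤ ‖W - W' - ((k : ℝ) * δ) • J (p - p')‖ + ‖(ex a' - 1) * (W - W')‖ + ‖(ex a - ex a' - (a - a')) * W‖ +
            ‖(a - a') * (W - 1)‖ + ‖a - a' - δ • J (p - p')‖ :=
            (norm_add_le _ _).trans (add_le_add ((norm_add_le _ _).trans (add_le_add
              ((norm_add_le _ _).trans (add_le_add (norm_add_le _ _) le_rfl)) le_rfl)) le_rfl)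
        _ ≤ 3 * g * k * N + 2 * θ * (n * (δ * ‖J‖) * N + 3 * g * k * N) + η * (δ * ‖J‖ * (2 * N)) * C +
            δ * ‖J‖ * (2 * N) * (2 * (n * θ) * C) + δ * ‖J‖ * (4 * (K * δ * (n : ℝ) ^ 2 * ‖J‖) * N) :=
            add_le_add (add_le_add (add_le_add (add_le_add ihb t1) t2) t3) hΔa'
        _ ≤ 3 * g * (↑(k + 1) : ℝ) * N := by push_cast; linarith
    refine ⟨?_, hb⟩
    -- (a_{k+1}): the momentum estimate
    have hms : (plfSeqTraj ex J Gs (fun _ => δ) p (k + 1)).2 = m + Gs (k + 1) (plfSeqTraj ex J Gs (fun _ => δ) p (k + 1)).1 := plfSeqTraj_succ_snd ex J Gs (fun _ => δ) p k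
    have hms' : (plfSeqTraj ex J Gs (fun _ => δ) p' (k + 1)).2 = m' + Gs (k + 1) (plfSeqTraj ex J Gs (fun _ => δ) p' (k + 1)).1 := plfSeqTraj_succ_snd ex J Gs (fun _ => δ) p' k
    have hk1 : 0 ≤ (↑(k + 1) : ℝ) * δ := mul_nonneg (Nat.cast_nonneg _) hδ
    have hWk1 : ‖(plfSeqTraj ex J Gs (fun _ => δ) p (k + 1)).1 - (plfSeqTraj ex J Gs (fun _ => δ) p' (k + 1)).1‖ ≤
        (↑(k + 1) : ℝ) * δ * (‖J‖ * N) + 3 * g * (↑(k + 1) : ℝ) * N := by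
      calc ‖(plfSeqTraj ex J Gs (fun _ => δ) p (k + 1)).1 - (plfSeqTraj ex J Gs (fun _ => δ) p' (k + 1)).1‖
          = ‖((plfSeqTraj ex J Gs (fun _ => δ) p (k + 1)).1 - (plfSeqTraj ex J Gs (fun _ => δ) p' (k + 1)).1 - (((↑(k + 1) : ℝ)) * δ) • J (p - p')) +
              (((↑(k + 1) : ℝ)) * δ) • J (p - p')‖ := by rw [sub_add_cancel]
        _ ≤ 3 * g * (↑(k + 1) : ℝ) * N + ‖(((↑(k + 1) : ℝ)) * δ) • J (p - p')‖ := (norm_add_le _ _).trans (add_le_add hb le_rfl)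
        _ ≤ 3 * g * (↑(k + 1) : ℝ) * N + (↑(k + 1) : ℝ) * δ * (‖J‖ * N) := by
            refine add_le_add le_rfl ?_
            rw [norm_smul, Real.norm_of_nonneg hk1]
            exact mul_le_mul_of_nonneg_left (J.le_opNorm _) hk1
        _ = (↑(k + 1) : ℝ) * δ * (‖J‖ * N) + 3 * g * (↑(k + 1) : ℝ) * N := by ring
    have hG2 : ‖Gs (k + 1) (plfSeqTraj ex J Gs (fun _ => δ) p (k + 1)).1 - Gs (k + 1) (plfSeqTraj ex J Gs (fun _ => δ) p' (k + 1)).1‖ ≤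
        2 * (K * ((↑(k + 1) : ℝ) * δ * (‖J‖ * N) + 3 * g * (↑(k + 1) : ℝ) * N)) := by
      have h1 : ‖Gs (k + 1) (plfSeqTraj ex J Gs (fun _ => δ) p (k + 1)).1 - Gs (k + 1) (plfSeqTraj ex J Gs (fun _ => δ) p' (k + 1)).1‖ ≤
          K * ((↑(k + 1) : ℝ) * δ * (‖J‖ * N) + 3 * g * (↑(k + 1) : ℝ) * N) :=
        (h.force_lip (k + 1) _ (plfSeqTraj_fst_mem h (fun _ => δ) p (k + 1)) _ (plfSeqTraj_fst_mem h (fun _ => δ) p' (k + 1))).trans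
          (mul_le_mul_of_nonneg_left hWk1 hK0)
      have h2 : 0 ≤ K * ((↑(k + 1) : ℝ) * δ * (‖J‖ * N) + 3 * g * (↑(k + 1) : ℝ) * N) :=
        mul_nonneg hK0 (by positivity)
      linarith
    have hsplit : (plfSeqTraj ex J Gs (fun _ => δ) p (k + 1)).2 - (plfSeqTraj ex J Gs (fun _ => δ) p' (k + 1)).2 - (p - p') =
        (m - m' - (p - p')) + (Gs (k + 1) (plfSeqTraj ex J Gs (fun _ => δ) p (k + 1)).1 - Gs (k + 1) (plfSeqTraj ex J Gs (fun _ => δ) p' (k + 1)).1) := by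
      rw [hms, hms']; abel
    rw [hsplit]
    calc ‖(m - m' - (p - p')) + (Gs (k + 1) (plfSeqTraj ex J Gs (fun _ => δ) p (k + 1)).1 - Gs (k + 1) (plfSeqTraj ex J Gs (fun _ => δ) p' (k + 1)).1)‖
        ≤ ‖m - m' - (p - p')‖ + ‖Gs (k + 1) (plfSeqTraj ex J Gs (fun _ => δ) p (k + 1)).1 - Gs (k + 1) (plfSeqTraj ex J Gs (fun _ => δ) p' (k + 1)).1‖ :=
          norm_add_le _ _
      _ ≤ K * (δ * ‖J‖ + 3 * g) * ((k : ℝ) * (k + 1)) * N + 2 * (K * ((↑(k + 1) : ℝ) * δ * (‖J‖ * N) + 3 * g * (↑(k + 1) : ℝ) * N)) :=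
          add_le_add iha hG2
      _ = K * (δ * ‖J‖ + 3 * g) * ((↑(k + 1) : ℝ) * ((↑(k + 1) : ℝ) + 1)) * N := by push_cast; ring

/-- **THE `n`-STEP PRODUCT IS A LIPSCHITZ-SMALL PERTURBATION OF `p ↦ W_n(0) + nδ·Jp` ON THE MOMENTUM
BALL**: `‖W_n(p) − W_n(p') − (nδ)•J(p − p')‖ ≤ plfSmall · (nδ‖J‖) · ‖p − p'‖`. -/
theorem plfSeqTraj_fst_approx {δ : ℝ} (hδ : 0 ≤ δ) {n : ℕ} {R : ℝ} {p p' : V} (hp : ‖p‖ ≤ R) (hp' : ‖p'‖ ≤ R)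
    (hρ : n * (δ * ‖J‖ * (R + (2 * n + 1) * b)) ≤ ρ) (hS : plfSmall J C K η δ b R n ≤ 1) :
    ‖(plfSeqTraj ex J Gs (fun _ => δ) p n).1 - (plfSeqTraj ex J Gs (fun _ => δ) p' n).1 - ((n : ℝ) * δ) • J (p - p')‖ ≤
      plfSmall J C K η δ b R n * ((n : ℝ) * δ * ‖J‖) * ‖p - p'‖ := by
  refine ((plfSeqTraj_two_point h hδ hp hp' hρ hS n le_rfl).2).trans (le_of_eq ?_)
  simp only [plfRate]
  ring

/-- **Upper Lipschitz bound**: `‖W_n(p) − W_n(p')‖ ≤ 2nδ‖J‖·‖p − p'‖` (as `plfSmall ≤ 1`). -/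
theorem plfSeqTraj_fst_lipschitz {δ : ℝ} (hδ : 0 ≤ δ) {n : ℕ} {R : ℝ} {p p' : V} (hp : ‖p‖ ≤ R) (hp' : ‖p'‖ ≤ R)
    (hρ : n * (δ * ‖J‖ * (R + (2 * n + 1) * b)) ≤ ρ) (hS : plfSmall J C K η δ b R n ≤ 1) :
    ‖(plfSeqTraj ex J Gs (fun _ => δ) p n).1 - (plfSeqTraj ex J Gs (fun _ => δ) p' n).1‖ ≤ 2 * ((n : ℝ) * δ * ‖J‖) * ‖p - p'‖ := by
  have h1 := plfSeqTraj_fst_approx h hδ hp hp' hρ hS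
  have hτ : 0 ≤ (n : ℝ) * δ := mul_nonneg n.cast_nonneg hδ
  have h2 : plfSmall J C K η δ b R n * ((n : ℝ) * δ * ‖J‖) * ‖p - p'‖ ≤ 1 * ((n : ℝ) * δ * ‖J‖) * ‖p - p'‖ :=
    mul_le_mul_of_nonneg_right (mul_le_mul_of_nonneg_right hS (mul_nonneg hτ (norm_nonneg _))) (norm_nonneg _)
  calc ‖(plfSeqTraj ex J Gs (fun _ => δ) p n).1 - (plfSeqTraj ex J Gs (fun _ => δ) p' n).1‖
      = ‖((plfSeqTraj ex J Gs (fun _ => δ) p n).1 - (plfSeqTraj ex J Gs (fun _ => δ) p' n).1 - ((n : ℝ) * δ) • J (p - p')) + ((n : ℝ) * δ) • J (p - p')‖ := by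
        rw [sub_add_cancel]
    _ ≤ plfSmall J C K η δ b R n * ((n : ℝ) * δ * ‖J‖) * ‖p - p'‖ + ‖((n : ℝ) * δ) • J (p - p')‖ := (norm_add_le _ _).trans (add_le_add h1 le_rfl)
    _ ≤ 1 * ((n : ℝ) * δ * ‖J‖) * ‖p - p'‖ + (n : ℝ) * δ * (‖J‖ * ‖p - p'‖) := by
        refine add_le_add h2 ?_
        rw [norm_smul, Real.norm_of_nonneg hτ]
        exact mul_le_mul_of_nonneg_left (J.le_opNorm _) hτ
    _ = 2 * ((n : ℝ) * δ * ‖J‖) * ‖p - p'‖ := by ring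

end TwoTrajectories

end Summit.Ventures.LatticeQCDFlow.Exactness

end
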